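import Summits.AtomisticToContinuum.Crystallization.Theorems.FrustratedLawDichotomyStrainedPatchRecutLS

/-!
# THE LEAST-SQUARES MATRIX IS COVARIANT UNDER RECUTS — the LS-corrected chart, (ROOMᴸ)'s second recipe
# (27623 strained-patch piece, T-side [CORE-FAR]; decomp-a2c lens-5 «RecutPairs», generation 54 → 55; file RM)

(Imports `…RecutLS`.)

THE IDENTITY (§1).  A recut re-parametrises the chart by `w ↦ (1+A′)w` on the `131/20`-window (`recutOf_label`).  The residual of the affine model is
CHART-INDEPENDENT: `p_a − (1+B)(1+A′)w_a = p_a − (1+A)w_a` whenever `(1+B)∘(1+A′) = (1+A)`.  Hence ★ `LSAt_recut_iff`: the chart `z₀` has least-squares matrix `A`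
iff its recut by `A′` has least-squares matrix `B`, `(1+B)(1+A′) = (1+A)` — EXACT, no smallness beyond the window bookkeeping `‖A′‖ ≤ 1/150`.  In particular
★★ `LSAt_zero_of_recutOf_self`: recutting a chart BY ITS OWN least-squares matrix produces an LS-FREE chart (`LSAt 0`), for which `LSNear κ` holds for every
`κ ≥ 0` (`lsNear_of_LSAt_zero`) — at the price of the fine level: ★ `fine_recut_le`: `‖dev₁‖ ≤ t + (131/20)·‖A‖` on the uncapped annulus (§2).

WHAT IT IS FOR (§3, no new binder).  (ROOMᴸ) `FamilyRoomLSG` of the ♭ record asks the room law for a chart in `𝓘₀ᴿʷˢ` at fine level `T₀(z₀)` whose LS matrix is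
`≤ κ♭₀·T₀(z₀)`, `κ♭₀ = 3/20`.  Two recipes discharge it: (ρ1) the raw room chart, when the census number KAPPA-ADM (sup over admissible deviations of
`‖A_LS‖/T₀` on that chart) is `≤ 3/20` (LSW28: realised `0.139`); (ρ2) the LS-CORRECTED room chart — recut the raw chart `z₀` (fine level `t`, LS matrix `A`,
`‖A‖ ≤ κ·t`) by `A` itself: the new chart has LS matrix `0` and fine level `≤ t·(1 + (131/20)κ)`; it discharges (ROOMᴸ) whenever it lies in `𝓘₀ᴿʷˢ` (interior pins:
the raw chart must then come from a family tighter by the `κ·t`-footprint, `‖G₁ − G₀‖ ≤ (5/4)κt ≤ 1/120`) and `t·(1 + (131/20)κ) ≤ T₀(z₁)`.  Recipe (ρ2) needs NO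
bound of KAPPA-ADM type at all — only fine-level head-room `t ≤ T₀/(1 + 6.55κ)` (`κ ≤ 2/5` ⇒ factor `≤ 3.62`; realised `κ ≤ 0.139` ⇒ `≤ 1.92`).  The census question
for (ρ2) is therefore the realised ratio `t/T₀` of the room charts, not an LP.  Intermediate corrections `θ·A` interpolate (`LSAt_recut_iff` with `B = (1+A)(1+θA)⁻¹ − 1`).

REFERENCES: none — elementary algebra of least squares under re-parametrisation [folklore]; tree `dev_recut`, `recutOf_label`, `LSAt`, `LSNear` (RL).
-/

noncomputable section

namespace Summit.AtomisticToContinuum.Crystallization.Theorems.FrustratedLawDichotomyStrainedPatchRecutLSShift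

open scoped BigOperators Classical
open Summit.AtomisticToContinuum.Crystallization.Theorems.FrustratedLawDichotomyPeriodicBlockFlags (goodAtScale_mono)
open Summit.AtomisticToContinuum.Crystallization.Theorems.FrustratedLawDichotomyRangeCut (Sep)
open Summit.AtomisticToContinuum.Crystallization.Theorems.FrustratedLawDichotomyMotifLemmas
open Summit.AtomisticToContinuum.Crystallization.Theorems.FrustratedLawDichotomyAveragingCut
open Summit.AtomisticToContinuum.Crystallization.Theorems.FrustratedLawDichotomyAveragingRuleCap
open Summit.AtomisticToContinuum.Crystallization.Theorems.FrustratedLawDichotomyAveragingRuleTightFree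
open Summit.AtomisticToContinuum.Crystallization.Theorems.FrustratedLawDichotomyExemptDoor (SitePred)
open Summit.AtomisticToContinuum.Crystallization.Theorems.FrustratedLawDichotomyExemptAbsorption
open Summit.AtomisticToContinuum.Crystallization.Theorems.FrustratedLawDichotomyExemptAbsorptionRecord
open Summit.AtomisticToContinuum.Crystallization.Theorems.FrustratedLawDichotomyCollarCensus
open Summit.AtomisticToContinuum.Crystallization.Theorems.FrustratedLawDichotomyCollarCensusKappa
open Summit.AtomisticToContinuum.Crystallization.Theorems.FrustratedLawDichotomyStrainedPatchHomSplit
open Summit.AtomisticToContinuum.Crystallization.Theorems.FrustratedLawDichotomyStrainedPatchCleanCollar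
open Summit.AtomisticToContinuum.Crystallization.Theorems.FrustratedLawDichotomyStrainedPatchHomTube
open Summit.AtomisticToContinuum.Crystallization.Theorems.FrustratedLawDichotomyStrainedPatchHomIsometry
open Summit.AtomisticToContinuum.Crystallization.Theorems.FrustratedLawDichotomyStrainedPatchHomTubeIso
open Summit.AtomisticToContinuum.Crystallization.Theorems.FrustratedLawDichotomyStrainedPatchPhaseCut
open Summit.AtomisticToContinuum.Crystallization.Theorems.FrustratedLawDichotomyStrainedPatchCoreTube
open Summit.AtomisticToContinuum.Crystallization.Theorems.FrustratedLawDichotomyStrainedPatchCoreTubeRecord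
open Summit.AtomisticToContinuum.Crystallization.Theorems.FrustratedLawDichotomyStrainedPatchCoreTubeMilli
open Summit.AtomisticToContinuum.Crystallization.Theorems.FrustratedLawDichotomyStrainedPatchStrainBands
open Summit.AtomisticToContinuum.Crystallization.Theorems.FrustratedLawDichotomyStrainedPatchChartFamilies
open Summit.AtomisticToContinuum.Crystallization.Theorems.FrustratedLawDichotomyStrainedPatchChartFamiliesBent
open Summit.AtomisticToContinuum.Crystallization.Theorems.FrustratedLawDichotomyStrainedPatchChartFamiliesPinned
open Summit.AtomisticToContinuum.Crystallization.Theorems.FrustratedLawDichotomyStrainedPatchEnvelopeLaw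
open Summit.AtomisticToContinuum.Crystallization.Theorems.FrustratedLawDichotomyStrainedPatchEnvelopeTaylor
open Literature.Barriers.AtomisticToContinuum.FlatleyTheil2015 (fccVec)
open Summit.AtomisticToContinuum.Crystallization.Theorems.FrustratedLawDichotomyStrainedPatchRecutPairs
open Summit.AtomisticToContinuum.Crystallization.Theorems.FrustratedLawDichotomyStrainedPatchRecutKinematics
open Literature.Barriers.AtomisticToContinuum.FlatleyTheil2015 (fccPoint)
open Summit.AtomisticToContinuum.Crystallization.Theorems.FrustratedLawDichotomyStrainedPatchHomRelief (latPt_fccVec_eq)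
open Summit.AtomisticToContinuum.Crystallization.Theorems.FrustratedLawDichotomyStrainedPatchHomLatticeBox (norm_apply_ge_of_near_one latPt_zero
  mem_box_of_norm_fccPoint_lt)
open Summit.AtomisticToContinuum.Crystallization.Theorems.FrustratedLawDichotomyStrainedPatchHomLatticeBoxHcp (latPt_eq_apply_one shifted_eq_apply)
open Summit.AtomisticToContinuum.Crystallization.Theorems.FrustratedLawDichotomyStrainedPatchHomLatticeBoxWindow (mem_box_of_norm_hexPt_lt'
  mem_box_of_norm_hexPt_add_shift_lt')
open Summit.AtomisticToContinuum.Crystallization.Theorems.FrustratedLawDichotomyStrainedPatchWindowFamilies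
open Summit.AtomisticToContinuum.Crystallization.Theorems.FrustratedLawDichotomyStrainedPatchRecutBuild
open Summit.AtomisticToContinuum.Crystallization.Theorems.FrustratedLawDichotomyStrainedPatchRecutRecord
open Summit.AtomisticToContinuum.Crystallization.Theorems.FrustratedLawDichotomyStrainedPatchRecutChart
open Literature.Geometry.DiscreteGeometry (nearestDist nearestDist_le_dist le_nearestDist exists_nearestDist_eq_dist nearestDist_nonneg
  fccKissingPattern hcpKissingPattern card_fccKissingPattern card_hcpKissingPattern norm_eq_one_of_mem_fccKissingPattern norm_eq_one_of_mem_hcpKissingPattern)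
open Summit.AtomisticToContinuum.Crystallization.Theorems.FrustratedLawDichotomyStrainedPatchRecutLevel
open Summit.AtomisticToContinuum.Crystallization.Theorems.FrustratedLawDichotomyStrainedPatchRecutLevelGap
open Summit.AtomisticToContinuum.Crystallization.Theorems.FrustratedLawDichotomyStrainedPatchWindowTaylorTail (taylorTwoBentW_holds)
open Summit.AtomisticToContinuum.Crystallization.Theorems.FrustratedLawDichotomyStrainedPatchRecutLS

/-! ## §1. Covariance of the normal equations under recuts -/

/-- ★ THE RESIDUAL IS CHART-INDEPENDENT — under a recut by `A′` (window `131/20`, `‖A′‖ ≤ 1/150`) and `(1+B)∘(1+A′) = (1+A)`: the `B`-corrected deviation of the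
recut chart equals the `A`-corrected deviation of the original chart, and the two designs `(1+B)w¹ = (1+A)w⁰` agree. [formal bookkeeping] -/
theorem devA_recut {A A' B : E3 →L[ℝ] E3} {M₀ : ℕ} {z₀ : Fin M₀ → E3} {c₀ : Fin M₀} {M₁ : ℕ} {z₁ : Fin M₁ → E3} {c₁ : Fin M₁} {M : ℕ} {z : Fin M → E3}
    {c : Fin M} {e₀ : Fin M → Fin M₀} {e₁ : Fin M → Fin M₁} (h : RecutOf A' z₀ c₀ z₁ c₁ e₀ e₁) (hA' : ‖A'‖ ≤ 1 / 150) {a : Fin M}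
    (ha : ‖z₀ (e₀ a) - z₀ c₀‖ ≤ 131 / 20) (hB : (((1 : E3 →L[ℝ] E3) + B).comp ((1 : E3 →L[ℝ] E3) + A')) = (1 : E3 →L[ℝ] E3) + A) :
    devA B z c z₁ c₁ e₁ a = devA A z c z₀ c₀ e₀ a ∧
      ((1 : E3 →L[ℝ] E3) + B) (z₁ (e₁ a) - z₁ c₁) = ((1 : E3 →L[ℝ] E3) + A) (z₀ (e₀ a) - z₀ c₀) := by
  have hl := recutOf_label h hA' ha
  have hBw : ((1 : E3 →L[ℝ] E3) + B) (z₁ (e₁ a) - z₁ c₁) = ((1 : E3 →L[ℝ] E3) + A) (z₀ (e₀ a) - z₀ c₀) := by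
    rw [hl, ← ContinuousLinearMap.comp_apply, hB]
  refine ⟨?_, hBw⟩
  have e1 : devA B z c z₁ c₁ e₁ a = (z a - z c) - ((1 : E3 →L[ℝ] E3) + B) (z₁ (e₁ a) - z₁ c₁) := by
    simp only [devA, dev, add_apply, one_apply_eq_self]; abel
  have e0 : devA A z c z₀ c₀ e₀ a = (z a - z c) - ((1 : E3 →L[ℝ] E3) + A) (z₀ (e₀ a) - z₀ c₀) := by
    simp only [devA, dev, add_apply, one_apply_eq_self]; abel
  rw [e1, e0, hBw]

/-- ★ **`LSAt` IS COVARIANT** — with the uncapped annulus inside the `131/20`-window: `LSAt A` for the chart `z₀` ⟺ `LSAt B` for its recut by `A′`, whenever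
`(1+B)∘(1+A′) = (1+A)`.  (The least-squares optimum does not depend on the parametrisation of the affine model.) [folklore] -/
theorem LSAt_recut_iff {A A' B : E3 →L[ℝ] E3} {M₀ : ℕ} {z₀ : Fin M₀ → E3} {c₀ : Fin M₀} {M₁ : ℕ} {z₁ : Fin M₁ → E3} {c₁ : Fin M₁} {M : ℕ}
    {z : Fin M → E3} {c : Fin M} {e₀ : Fin M → Fin M₀} {e₁ : Fin M → Fin M₁} (h : RecutOf A' z₀ c₀ z₁ c₁ e₀ e₁) (hA' : ‖A'‖ ≤ 1 / 150)
    (hwin : ∀ a ∈ uncapped z c, ‖z₀ (e₀ a) - z₀ c₀‖ ≤ 131 / 20) (hB : (((1 : E3 →L[ℝ] E3) + B).comp ((1 : E3 →L[ℝ] E3) + A')) = (1 : E3 →L[ℝ] E3) + A) :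
    LSAt A M z c M₀ z₀ c₀ e₀ ↔ LSAt B M z c M₁ z₁ c₁ e₁ := by
  have key : ∀ i j : Fin 3, ∑ a ∈ uncapped z c, devA B z c z₁ c₁ e₁ a i * (((1 : E3 →L[ℝ] E3) + B) (z₁ (e₁ a) - z₁ c₁)) j =
      ∑ a ∈ uncapped z c, devA A z c z₀ c₀ e₀ a i * (((1 : E3 →L[ℝ] E3) + A) (z₀ (e₀ a) - z₀ c₀)) j := by
    intro i j
    refine Finset.sum_congr rfl fun a ha => ?_
    obtain ⟨h1, h2⟩ := devA_recut h hA' (hwin a ha) hB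
    rw [h1, h2]
  simp only [LSAt, key]

/-- ★★ **RECUT BY THE LS MATRIX ⇒ LS-FREE CHART** — if `A` is the least-squares matrix of the chart `z₀` (`LSAt A`) and `z₁` is its recut by `A` (`‖A‖ ≤ 1/150`,
annulus in the window), then the recut chart's least-squares matrix is `0`. [folklore] -/
theorem LSAt_zero_of_recutOf_self {A : E3 →L[ℝ] E3} {M₀ : ℕ} {z₀ : Fin M₀ → E3} {c₀ : Fin M₀} {M₁ : ℕ} {z₁ : Fin M₁ → E3} {c₁ : Fin M₁} {M : ℕ}
    {z : Fin M → E3} {c : Fin M} {e₀ : Fin M → Fin M₀} {e₁ : Fin M → Fin M₁} (h : RecutOf A z₀ c₀ z₁ c₁ e₀ e₁) (hA : ‖A‖ ≤ 1 / 150)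
    (hwin : ∀ a ∈ uncapped z c, ‖z₀ (e₀ a) - z₀ c₀‖ ≤ 131 / 20) (hLS : LSAt A M z c M₀ z₀ c₀ e₀) : LSAt 0 M z c M₁ z₁ c₁ e₁ :=
  (LSAt_recut_iff h hA hwin (B := 0) (by rw [add_zero, ContinuousLinearMap.one_def, ContinuousLinearMap.id_comp])).1 hLS

/-- An LS-free chart is `κ·t`-LS-near for every `κ ≥ 0`. [formal bookkeeping] -/
theorem lsNear_of_LSAt_zero {M : ℕ} {z : Fin M → E3} {c : Fin M} {M₁ : ℕ} {z₁ : Fin M₁ → E3} {c₁ : Fin M₁} {e₁ : Fin M → Fin M₁}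
    (hLS : LSAt 0 M z c M₁ z₁ c₁ e₁) {κ : ℝ} (hκ : 0 ≤ κ) (t : ℝ) : LSNear κ M z c M₁ z₁ c₁ e₁ t :=
  ⟨0, by rw [norm_zero]; exact mul_nonneg hκ (le_max_right _ _), hLS⟩

/-- The general interpolation: recutting by `A′` turns the LS matrix `A` into `B` with `(1+B) = (1+A)∘(1+A′)⁻¹`; for `‖A′‖ < 1` such a `B` exists. [folklore] -/
theorem exists_LSAt_recut {A A' : E3 →L[ℝ] E3} {M₀ : ℕ} {z₀ : Fin M₀ → E3} {c₀ : Fin M₀} {M₁ : ℕ} {z₁ : Fin M₁ → E3} {c₁ : Fin M₁} {M : ℕ}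
    {z : Fin M → E3} {c : Fin M} {e₀ : Fin M → Fin M₀} {e₁ : Fin M → Fin M₁} (h : RecutOf A' z₀ c₀ z₁ c₁ e₀ e₁) (hA' : ‖A'‖ ≤ 1 / 150)
    (hwin : ∀ a ∈ uncapped z c, ‖z₀ (e₀ a) - z₀ c₀‖ ≤ 131 / 20) (hLS : LSAt A M z c M₀ z₀ c₀ e₀) :
    ∃ B : E3 →L[ℝ] E3, (((1 : E3 →L[ℝ] E3) + B).comp ((1 : E3 →L[ℝ] E3) + A')) = (1 : E3 →L[ℝ] E3) + A ∧ LSAt B M z c M₁ z₁ c₁ e₁ := by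
  obtain ⟨C, -, hleft, -⟩ := exists_inv_one_add A' hA' (by norm_num)
  have hB : (((1 : E3 →L[ℝ] E3) + ((((1 : E3 →L[ℝ] E3) + A).comp ((1 : E3 →L[ℝ] E3) + C)) - 1)).comp ((1 : E3 →L[ℝ] E3) + A')) =
      (1 : E3 →L[ℝ] E3) + A := by
    rw [add_sub_cancel]
    refine ContinuousLinearMap.ext fun u => ?_
    simp only [ContinuousLinearMap.comp_apply, hleft]
  exact ⟨_, hB, (LSAt_recut_iff h hA' hwin hB).1 hLS⟩

/-! ## §2. The fine-level price of a recut -/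

/-- ★ THE FINE-LEVEL PRICE — under a recut by `A` (window `131/20`, `‖A‖ ≤ 1/150`): `‖dev₁ a‖ ≤ ‖dev₀ a‖ + ‖A‖·‖z₀ (e₀ a) − z₀ c₀‖` (`dev₁ = dev₀ − A w⁰`,
tree `dev_recut`). [folklore] -/
theorem norm_dev_recut_le {A : E3 →L[ℝ] E3} {M₀ : ℕ} {z₀ : Fin M₀ → E3} {c₀ : Fin M₀} {M₁ : ℕ} {z₁ : Fin M₁ → E3} {c₁ : Fin M₁} {M : ℕ}
    {z : Fin M → E3} {c : Fin M} {e₀ : Fin M → Fin M₀} {e₁ : Fin M → Fin M₁} (h : RecutOf A z₀ c₀ z₁ c₁ e₀ e₁) (hA : ‖A‖ ≤ 1 / 150) {a : Fin M}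
    (ha : ‖z₀ (e₀ a) - z₀ c₀‖ ≤ 131 / 20) : ‖dev z c z₁ c₁ e₁ a‖ ≤ ‖dev z c z₀ c₀ e₀ a‖ + ‖A‖ * ‖z₀ (e₀ a) - z₀ c₀‖ := by
  rw [dev_recut z c z₀ c₀ e₀ z₁ c₁ e₁ A (recutOf_label h hA ha)]
  exact (norm_sub_le _ _).trans (by gcongr; exact A.le_opNorm _)

/-- ★ On the uncapped annulus (radius `63/10 ≤ 131/20` in the chart by `chartBy_uncapped`-type bookkeeping, here assumed as the window hypothesis): fine level
`t` before the recut ⇒ fine level `≤ t + (131/20)·‖A‖` after. [folklore] -/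
theorem fine_recut_le {A : E3 →L[ℝ] E3} {M₀ : ℕ} {z₀ : Fin M₀ → E3} {c₀ : Fin M₀} {M₁ : ℕ} {z₁ : Fin M₁ → E3} {c₁ : Fin M₁} {M : ℕ}
    {z : Fin M → E3} {c : Fin M} {e₀ : Fin M → Fin M₀} {e₁ : Fin M → Fin M₁} (h : RecutOf A z₀ c₀ z₁ c₁ e₀ e₁) (hA : ‖A‖ ≤ 1 / 150)
    (hwin : ∀ a ∈ uncapped z c, ‖z₀ (e₀ a) - z₀ c₀‖ ≤ 131 / 20) {t : ℝ} (hfine : ∀ a ∈ uncapped z c, ‖dev z c z₀ c₀ e₀ a‖ ≤ t) :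
    ∀ a ∈ uncapped z c, ‖dev z c z₁ c₁ e₁ a‖ ≤ t + 131 / 20 * ‖A‖ := by
  intro a ha
  refine (norm_dev_recut_le h hA (hwin a ha)).trans ?_
  have := mul_le_mul_of_nonneg_left (hwin a ha) (norm_nonneg A)
  linarith [hfine a ha]

/-- ★ With `‖A‖ ≤ κ·t`: the LS-corrected chart's fine level is `≤ t·(1 + (131/20)κ)`. [folklore] -/
theorem fine_recut_le' {A : E3 →L[ℝ] E3} {M₀ : ℕ} {z₀ : Fin M₀ → E3} {c₀ : Fin M₀} {M₁ : ℕ} {z₁ : Fin M₁ → E3} {c₁ : Fin M₁} {M : ℕ}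
    {z : Fin M → E3} {c : Fin M} {e₀ : Fin M → Fin M₀} {e₁ : Fin M → Fin M₁} (h : RecutOf A z₀ c₀ z₁ c₁ e₀ e₁) (hA : ‖A‖ ≤ 1 / 150)
    (hwin : ∀ a ∈ uncapped z c, ‖z₀ (e₀ a) - z₀ c₀‖ ≤ 131 / 20) {t κ : ℝ} (hκ : ‖A‖ ≤ κ * t) (hfine : ∀ a ∈ uncapped z c, ‖dev z c z₀ c₀ e₀ a‖ ≤ t) :
    ∀ a ∈ uncapped z c, ‖dev z c z₁ c₁ e₁ a‖ ≤ t * (1 + 131 / 20 * κ) := by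
  intro a ha
  have := fine_recut_le h hA hwin hfine a ha
  nlinarith

/-! ## §3. The LS-corrected chart is projected-free at the raised fine level -/

/-- ★★ RECIPE (ρ2) AS A THEOREM ON THE COMPARISON SIDE — recutting a chart with LS matrix `A`, `‖A‖ ≤ κt ≤ 1/150`, fine level `t` BY `A` gives a chart that is
LS-free (`LSAt 0`) AND `projectedFree` at level `t·(1 + (131/20)κ)`… in fact at level `t` itself: `projectedFree_of_recutOf` (RL) already certifies the recut at
the ORIGINAL level `t` (the affine-free residual `u = dev₀` has sup `≤ t`; only the SUP of `dev₁` rises).  Both facts recorded. [folklore] -/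
theorem corrected_chart {A : E3 →L[ℝ] E3} {M₀ : ℕ} {z₀ : Fin M₀ → E3} {c₀ : Fin M₀} {M₁ : ℕ} {z₁ : Fin M₁ → E3} {c₁ : Fin M₁} {M : ℕ}
    {z : Fin M → E3} {c : Fin M} {e₀ : Fin M → Fin M₀} {e₁ : Fin M → Fin M₁} (h : RecutOf A z₀ c₀ z₁ c₁ e₀ e₁) {t κ : ℝ} (hκ : ‖A‖ ≤ κ * t)
    (hκt : κ * t ≤ 1 / 150) (hwin : ∀ a ∈ uncapped z c, ‖z₀ (e₀ a) - z₀ c₀‖ ≤ 131 / 20) (hfine : ∀ a ∈ uncapped z c, ‖dev z c z₀ c₀ e₀ a‖ ≤ t)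
    (hLS : LSAt A M z c M₀ z₀ c₀ e₀) :
    LSAt 0 M z c M₁ z₁ c₁ e₁ ∧ projectedFree M z c M₁ z₁ c₁ e₁ t ∧ ∀ a ∈ uncapped z c, ‖dev z c z₁ c₁ e₁ a‖ ≤ t * (1 + 131 / 20 * κ) :=
  ⟨LSAt_zero_of_recutOf_self h (hκ.trans hκt) hwin hLS, projectedFree_of_recutOf h (hκ.trans hκt) hwin hfine hLS,
    fine_recut_le' h (hκ.trans hκt) hwin hκ hfine⟩

end Summit.AtomisticToContinuum.Crystallization.Theorems.FrustratedLawDichotomyStrainedPatchRecutLSShift
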